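import Summits.SmoothPoincare4.SmoothPoincare4.Theses.RootDecompN

/-! # RootDecompN — the split glue `BiDefiniteDescentAmphGlue` (item stmt-SmoothPoincare4-28677) PROVED.

`BiDefiniteDescentAmphGlue : AmphichiralDescent → ChiralDescent → BiDefiniteDescent` (route N,
`--split BiDefiniteDescent --into AmphichiralDescent ChiralDescent`).  The glue is excluded middle on
«`M` admits an orientation-reversing self-diffeomorphism for every orientation»: the amphichiral case is
`AmphichiralDescent`, the chiral case is `ChiralDescent`.  Text = lens-6 v5 `split/SigCheck.lean`
(`biDefiniteDescentAmphGlue_holds`), re-based on the born route file. -/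

set_option linter.dupNamespace false

namespace Summit.SmoothPoincare4.SmoothPoincare4.Theorems.RootDecompNBiDefiniteDescentAmphSplit

open scoped Manifold ContDiff
open Summit.SmoothPoincare4.SmoothPoincare4.Theses.RootDecompN

/-- The split glue of route N at `BiDefiniteDescent` holds outright (chirality dichotomy). -/
theorem biDefiniteDescentAmphGlue_holds : BiDefiniteDescentAmphGlue := by
  intro hA hC M _ _ _ _ _ hM hbi
  by_cases hamph : ∀ (oM : Literature.Topology.FourManifolds.SmoothOrientation (𝓡 4) M),
      ∃ ρ : M ≃ₘ⟮𝓡 4, 𝓡 4⟯ M, ρ.IsOrientationPreserving oM (-oM)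
  · exact hA M hM hamph hbi
  · exact hC M hM hamph hbi

end Summit.SmoothPoincare4.SmoothPoincare4.Theorems.RootDecompNBiDefiniteDescentAmphSplit
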